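import Mathlib
import Summits.CriticalPhenomena.SAWScalingLimit.Theorems.SAWDefectDecoherenceObservableToSLERNestedGateDefs
import Summits.CriticalPhenomena.SAWScalingLimit.Theorems.SAWDefectDecoherenceObservableToSLERGateTransferCells
import Summits.CriticalPhenomena.SAWScalingLimit.Theorems.SAWDefectDecoherenceObservableToSLERGateTransferRootSide

/-!
# Nested transfer, assembly 1: first exits, cells and product cells over tame nested families

Support file for the stub `stub_nestedTransfer` (the nested transfer
`GateDecomposition → NestedRenewal → CarvedToSLEN → HexTight → FullIdentification`) of the line
`bridge-gate-renewal` (reshape r3: nested tame gate families) for the crux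
`Summit.CriticalPhenomena.SAWScalingLimit.Theses.SAWDefectDecoherence.ObservableToSLER`
(item `stmt-CriticalPhenomena-14005`).  Port of
`Theorems/SAWDefectDecoherenceObservableToSLERGateTransferCells.lean` (hexagon-level gates) to the
vocabulary of `Theorems/SAWDefectDecoherenceObservableToSLERNestedGateDefs.lean`
(`IsFirstExitFrom`, `IsGoodGateN`, `IsFirstGoodGateN`, `GoodRenewalAtN`): the root side of a gate at
level `n` of a family `S` IS the vertex set `S n`.

* index bookkeeping for `IsFirstExitFrom` (`getElem?_eq`, `pos`, `lt_length`, `getElem?_pred_eq`,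
  membership of `p`, `q`, uniqueness of the first-exit data, adjacency of the exit edge);
* `IsFirstGoodGateN.unique` — first good gates are unique;
* `GateLabel.cellN` (the cell of a label: first good gates, prefix, suffix), `productCellN` (the
  set of walks whose cell is a product), and the bookkeeping between cells and the cylinders
  `GateLabel.cyl (S n) (T n')` of `GateDecomposition`: a cell member lies in the cylinder of its
  label and conversely inside a product cell (registered sub-goal `stub_cellEqCylinderN`), labels
  are determined by the walk, every walk of the good event has a label.
-/

noncomputable section

open scoped BigOperators Topology NNReal ENNReal Classical
open Filter Set MeasureTheory Metric

namespace Summit.CriticalPhenomena.SAWScalingLimit.Theorems.ObservableToSLER.NestedGate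

open Literature.Probability.LatticeModels (HexVertex hexGraph hexCenter triZeta Site)
open Literature.Probability.RandomPlanarGeometry
open Literature.Probability.RandomPlanarGeometry.SAW
open Summit.CriticalPhenomena.SAWScalingLimit.Theorems.ObservableToSLER.BridgeGate

section FirstExit

variable {S : Set HexVertex} {l : List HexVertex} {m : ℕ} {p q : HexVertex}

/-- In a first exit the exit index is inside the list and the exit vertex is the entry there. -/
theorem IsFirstExitFrom.getElem?_eq (h : IsFirstExitFrom S l m p q) : l[m]? = some q := by
  rw [← List.head?_drop]; exact h.2.1

/-- In a first exit the exit index is positive. -/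
theorem IsFirstExitFrom.pos (h : IsFirstExitFrom S l m p q) : 0 < m := by
  rcases Nat.eq_zero_or_pos m with rfl | hm
  · exact absurd h.1 (by simp)
  · exact hm

/-- In a first exit the exit index is less than the length of the list. -/
theorem IsFirstExitFrom.lt_length (h : IsFirstExitFrom S l m p q) : m < l.length := by
  have := h.getElem?_eq
  rw [List.getElem?_eq_some_iff] at this
  exact this.1

/-- In a first exit the last inside vertex is the entry at index `m - 1`. -/
theorem IsFirstExitFrom.getElem?_pred_eq (h : IsFirstExitFrom S l m p q) : l[m - 1]? = some p := by
  have hm := h.pos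
  have hml := h.lt_length
  have h1 := h.1
  rw [List.getLast?_eq_getElem?, List.length_take, min_eq_left hml.le, List.getElem?_take] at h1
  simpa [Nat.sub_lt hm one_pos] using h1

/-- In a first exit, `p` is one of the first `m` entries. -/
theorem IsFirstExitFrom.fst_mem_take (h : IsFirstExitFrom S l m p q) : p ∈ l.take m :=
  List.mem_of_getElem? (by
    rw [List.getElem?_take, if_pos (Nat.sub_lt h.pos one_pos)]; exact h.getElem?_pred_eq)

/-- In a first exit, `q` is one of the entries from index `m` on. -/
theorem IsFirstExitFrom.snd_mem_drop (h : IsFirstExitFrom S l m p q) : q ∈ l.drop m :=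
  List.mem_iff_getElem?.2 ⟨0, by rw [List.getElem?_drop, Nat.add_zero]; exact h.getElem?_eq⟩

/-- In a first exit, `p` lies in the set. -/
theorem IsFirstExitFrom.fst_mem_set (h : IsFirstExitFrom S l m p q) : p ∈ S :=
  h.2.2.1 p h.fst_mem_take

/-- **First-exit data from a given set are unique.** -/
theorem IsFirstExitFrom.unique {m' : ℕ} {p' q' : HexVertex} (h : IsFirstExitFrom S l m p q)
    (h' : IsFirstExitFrom S l m' p' q') : m = m' ∧ p = p' ∧ q = q' := by
  -- the exit indices agree: a smaller exit index would put an outside vertex inside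
  have key : ∀ {m₁ m₂ : ℕ} {p₁ q₁ p₂ q₂ : HexVertex}, IsFirstExitFrom S l m₁ p₁ q₁ →
      IsFirstExitFrom S l m₂ p₂ q₂ → ¬ m₁ < m₂ := by
    intro m₁ m₂ p₁ q₁ p₂ q₂ h₁ h₂ hlt
    have hq : l[m₁]? = some q₁ := h₁.getElem?_eq
    rw [List.getElem?_eq_some_iff] at hq
    obtain ⟨hm₁, rfl⟩ := hq
    apply h₁.2.2.2
    apply h₂.2.2.1
    rw [List.mem_take_iff_getElem]
    exact ⟨m₁, by rw [Nat.lt_min]; exact ⟨hlt, hm₁⟩, rfl⟩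
  have hm : m = m' := by
    rcases lt_trichotomy m m' with hlt | heq | hgt
    · exact absurd hlt (key h h')
    · exact heq
    · exact absurd hgt (key h' h)
  subst hm
  refine ⟨rfl, ?_, ?_⟩
  · have := h.getElem?_pred_eq.symm.trans h'.getElem?_pred_eq
    simpa using this
  · have := h.getElem?_eq.symm.trans h'.getElem?_eq
    simpa using this

variable {Ω : Set ℂ} {δ : ℝ}

/-- A walk with a first exit has an edge. -/
theorem not_nil_of_isFirstExitFrom {u v : HexVertex} (w : (hexDomainGraph Ω δ).Walk u v)
    (h : IsFirstExitFrom S w.support m p q) : ¬ w.Nil := by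
  rw [← SimpleGraph.Walk.length_eq_zero_iff]
  intro h0
  have h1 := h.lt_length
  have h2 := h.pos
  rw [SimpleGraph.Walk.length_support, h0] at h1
  omega

/-- In a first exit of a walk, `p` and `q` are adjacent in `Ω_δ`. -/
theorem IsFirstExitFrom.adj {u v : HexVertex} (w : (hexDomainGraph Ω δ).Walk u v)
    (h : IsFirstExitFrom S w.support m p q) : (hexDomainGraph Ω δ).Adj p q := by
  have hm := h.pos
  have hml := h.lt_length
  have hp := h.getElem?_pred_eq
  have hq := h.getElem?_eq
  rw [List.getElem?_eq_some_iff] at hp hq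
  obtain ⟨_, rfl⟩ := hp
  obtain ⟨_, rfl⟩ := hq
  have := adj_of_getElem w (i := m - 1) (by omega)
  simpa [Nat.sub_add_cancel hm] using this

end FirstExit

section GoodGate

variable {Ω : Set ℂ} {δ ρ R : ℝ} {S : ℕ → Set HexVertex} {c : HexVertex} {l : List HexVertex}

/-- **First good gates are unique.** -/
theorem IsFirstGoodGateN.unique {n m n' m' : ℕ} {p q p' q' : HexVertex}
    (h : IsFirstGoodGateN Ω δ ρ R S c l n m p q) (h' : IsFirstGoodGateN Ω δ ρ R S c l n' m' p' q') :
    n = n' ∧ m = m' ∧ p = p' ∧ q = q' := by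
  have hn : n = n' := le_antisymm (h.2 _ _ _ _ h'.1) (h'.2 _ _ _ _ h.1)
  subst hn
  exact ⟨rfl, h.1.1.unique h'.1.1⟩

/-- A first good gate is in particular a good renewal. -/
theorem IsFirstGoodGateN.goodRenewalAtN {n m : ℕ} {p q : HexVertex}
    (h : IsFirstGoodGateN Ω δ ρ R S c l n m p q) : GoodRenewalAtN Ω δ ρ R S c l :=
  ⟨n, m, p, q, h.1⟩

end GoodGate

section Cells

variable {Ω : Set ℂ} {δ ρ R : ℝ} {S T : ℕ → Set HexVertex} {a b : HexVertex}

/-- The cell labelled `κ` over the families `S` (at `a`) and `T` (at `b`, list reversed), as a set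
of vertex lists `L`: the first good gates of `L` are those of `κ`, its prefix and suffix are those
of `κ`. -/
def _root_.Summit.CriticalPhenomena.SAWScalingLimit.Theorems.ObservableToSLER.BridgeGate.GateLabel.cellN
    (κ : GateLabel) (Ω : Set ℂ) (δ ρ R : ℝ) (S T : ℕ → Set HexVertex) (a b : HexVertex) :
    Set (List HexVertex) :=
  {L | IsFirstGoodGateN Ω δ ρ R S a L κ.n κ.m κ.p κ.q ∧
    IsFirstGoodGateN Ω δ ρ R T b L.reverse κ.n' κ.m' κ.p' κ.q' ∧
    L.take κ.m = κ.l₁ ∧ L.drop (L.length - κ.m') = κ.l₂}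

/-- **The product cells at mesh `δ` over the families `S`, `T`**, as the set of walks `γ₀` whose
cell is a product: for all first good gates `(n; m, p, q)` in `S`, `(n'; m', p', q')` in `T` (list
reversed) of `γ₀` (prefix `l₁`, suffix `l₂`), the two removed sets `S n`, `T n'` are disjoint, the
prefix is a SAW from `a` to `p` inside `S n`, the suffix a SAW from `p'` to `b` inside `T n'`, the
gates are lattice edges, the middle piece is nonempty, EVERY walk `l₁ ++ mid ++ l₂` with `mid` from
`q` to `q'` avoiding `S n ∪ T n'` has the same first good gates, and the prefix (suffix) vertices
are within `C` of `q` (`q'`). -/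
def productCellN (Ω : Set ℂ) (δ ρ R : ℝ) (S T : ℕ → Set HexVertex) (a b : HexVertex) (C : ℝ) :
    Set (HexDomainSAW Ω δ a b) :=
  {γ₀ | ∀ (n m : ℕ) (p q : HexVertex) (n' m' : ℕ) (p' q' : HexVertex),
    IsFirstGoodGateN Ω δ ρ R S a γ₀.walk.support n m p q →
    IsFirstGoodGateN Ω δ ρ R T b γ₀.walk.support.reverse n' m' p' q' →
    Disjoint (S n) (T n') ∧
    (∃ w₁ : (hexDomainGraph Ω δ).Walk a p, w₁.IsPath ∧
      w₁.support = γ₀.walk.support.take m ∧ ∀ v ∈ γ₀.walk.support.take m, v ∈ S n) ∧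
    (∃ w₂ : (hexDomainGraph Ω δ).Walk p' b, w₂.IsPath ∧
      w₂.support = γ₀.walk.support.drop (γ₀.walk.support.length - m') ∧
      ∀ v ∈ γ₀.walk.support.drop (γ₀.walk.support.length - m'), v ∈ T n') ∧
    (hexDomainGraph Ω δ).Adj p q ∧ (hexDomainGraph Ω δ).Adj q' p' ∧
    m + m' < γ₀.walk.support.length ∧
    (∀ (γ : HexDomainSAW Ω δ a b) (mid : List HexVertex), mid.head? = some q →
      mid.getLast? = some q' → (∀ v ∈ mid, v ∉ S n ∧ v ∉ T n') →
      γ.walk.support = γ₀.walk.support.take m ++ mid ++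
        γ₀.walk.support.drop (γ₀.walk.support.length - m') →
      IsFirstGoodGateN Ω δ ρ R S a γ.walk.support n m p q ∧
      IsFirstGoodGateN Ω δ ρ R T b γ.walk.support.reverse n' m' p' q') ∧
    (∀ x ∈ γ₀.walk.support.take m, dist ((δ : ℂ) * hexCenter x) ((δ : ℂ) * hexCenter q) ≤ C) ∧
    (∀ x ∈ γ₀.walk.support.drop (γ₀.walk.support.length - m'),
      dist ((δ : ℂ) * hexCenter x) ((δ : ℂ) * hexCenter q') ≤ C)}

/-- In a cell member the middle piece starts at `q`. -/
theorem head?_midList_of_mem_cellN {κ : GateLabel} {L : List HexVertex}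
    (h : L ∈ κ.cellN Ω δ ρ R S T a b) (hlen : κ.m + κ.m' < L.length) :
    (midList κ.m κ.m' L).head? = some κ.q := by
  rw [midList, List.head?_take, if_neg (by omega), List.head?_drop]
  exact h.1.1.1.getElem?_eq

/-- In a cell member the middle piece ends at `q'`. -/
theorem getLast?_midList_of_mem_cellN {κ : GateLabel} {L : List HexVertex}
    (h : L ∈ κ.cellN Ω δ ρ R S T a b) (hlen : κ.m + κ.m' < L.length) :
    (midList κ.m κ.m' L).getLast? = some κ.q' := by
  have hq' := h.2.1.1.1.getElem?_eq
  rw [← List.head?_drop, List.drop_reverse, List.head?_reverse] at hq'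
  have : midList κ.m κ.m' L = (L.take (L.length - κ.m')).drop κ.m := by
    rw [midList, List.drop_take, Nat.sub_right_comm]
  rw [this, List.getLast?_drop, if_neg (by simp; omega)]
  exact hq'

/-- In a cell member the middle piece avoids both removed sets (no return at both ends). -/
theorem midList_avoids_of_mem_cellN {κ : GateLabel} {L : List HexVertex}
    (h : L ∈ κ.cellN Ω δ ρ R S T a b) :
    ∀ v ∈ midList κ.m κ.m' L, v ∉ S κ.n ∧ v ∉ T κ.n' := by
  intro v hv
  constructor
  · apply h.1.1.2.1
    rw [midList] at hv
    exact List.mem_of_mem_take hv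
  · apply h.2.1.1.2.1
    rw [List.drop_reverse, List.mem_reverse]
    have : midList κ.m κ.m' L = (L.take (L.length - κ.m')).drop κ.m := by
      rw [midList, List.drop_take, Nat.sub_right_comm]
    rw [this] at hv
    exact List.mem_of_mem_drop hv

/-- A cell member lies in the cylinder of its label (given that its middle piece is nonempty). -/
theorem mem_cyl_of_mem_cellN {κ : GateLabel} {γ : HexDomainSAW Ω δ a b}
    (h : γ.walk.support ∈ κ.cellN Ω δ ρ R S T a b) (hlen : κ.m + κ.m' < γ.walk.support.length) :
    γ ∈ κ.cyl (S κ.n) (T κ.n') Ω δ a b := by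
  refine ⟨midList κ.m κ.m' γ.walk.support, head?_midList_of_mem_cellN h hlen,
    getLast?_midList_of_mem_cellN h hlen, midList_avoids_of_mem_cellN h, ?_⟩
  rw [← h.2.2.1, ← h.2.2.2, take_append_midList_append_drop hlen.le]

/-- Conversely, inside a product cell, a walk in the cylinder of the label of a cell member is a
member of the same cell. -/
theorem mem_cellN_of_mem_cyl {C : ℝ} {κ : GateLabel} {γ₀ γ : HexDomainSAW Ω δ a b}
    (hcs : γ₀ ∈ productCellN Ω δ ρ R S T a b C) (h₀ : γ₀.walk.support ∈ κ.cellN Ω δ ρ R S T a b)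
    (hγ : γ ∈ κ.cyl (S κ.n) (T κ.n') Ω δ a b) :
    γ.walk.support ∈ κ.cellN Ω δ ρ R S T a b := by
  obtain ⟨mid, hh, hl, hav, hsupp⟩ := hγ
  obtain ⟨-, -, -, -, -, hlen, htr, -, -⟩ := hcs κ.n κ.m κ.p κ.q κ.n' κ.m' κ.p' κ.q' h₀.1 h₀.2.1
  rw [h₀.2.2.1, h₀.2.2.2] at htr
  obtain ⟨h1, h2⟩ := htr γ mid hh hl hav hsupp
  have hm : κ.l₁.length = κ.m := by
    rw [← h₀.2.2.1, List.length_take]; exact min_eq_left (by omega)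
  have hm' : κ.l₂.length = κ.m' := by
    rw [← h₀.2.2.2, List.length_drop]; omega
  refine ⟨h1, h2, ?_, ?_⟩
  · rw [hsupp, List.append_assoc, List.take_append_of_le_length hm.ge, ← hm, List.take_length]
  · rw [hsupp, List.length_append, List.length_append, hm']
    rw [show κ.l₁.length + mid.length + κ.m' - κ.m' = (κ.l₁ ++ mid).length by simp,
      List.drop_append_of_le_length le_rfl, List.drop_length]
    simp

/-- The first good gates of a cell member determine its label. -/
theorem _root_.Summit.CriticalPhenomena.SAWScalingLimit.Theorems.ObservableToSLER.BridgeGate.GateLabel.eq_of_mem_cellN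
    {κ κ' : GateLabel} {L : List HexVertex}
    (h : L ∈ κ.cellN Ω δ ρ R S T a b) (h' : L ∈ κ'.cellN Ω δ ρ R S T a b) : κ = κ' := by
  obtain ⟨h1, h2, h3, h4⟩ := h.1.unique h'.1
  obtain ⟨h5, h6, h7, h8⟩ := h.2.1.unique h'.2.1
  have h9 : κ.l₁ = κ'.l₁ := by rw [← h.2.2.1, ← h'.2.2.1, h2]
  have h10 : κ.l₂ = κ'.l₂ := by rw [← h.2.2.2, ← h'.2.2.2, h6]
  cases κ; cases κ'
  simp only at h1 h2 h3 h4 h5 h6 h7 h8 h9 h10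
  simp [h1, h2, h3, h4, h5, h6, h7, h8, h9, h10]

/-- Every walk of the good event is a member of some cell. -/
theorem exists_mem_cellN {L : List HexVertex} (ha : GoodRenewalAtN Ω δ ρ R S a L)
    (hb : GoodRenewalAtN Ω δ ρ R T b L.reverse) :
    ∃ κ : GateLabel, L ∈ κ.cellN Ω δ ρ R S T a b := by
  obtain ⟨n, m, p, q, h1⟩ := stub_firstGoodGateN Ω δ ρ R S a L ha
  obtain ⟨n', m', p', q', h2⟩ := stub_firstGoodGateN Ω δ ρ R T b L.reverse hb
  exact ⟨⟨n, m, p, q, n', m', p', q', L.take m, L.drop (L.length - m')⟩, h1, h2, rfl, rfl⟩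

end Cells

end Summit.CriticalPhenomena.SAWScalingLimit.Theorems.ObservableToSLER.NestedGate

namespace Summit.CriticalPhenomena.SAWScalingLimit.Theorems.ObservableToSLER.NestedGate

open Literature.Probability.LatticeModels (HexVertex hexGraph hexCenter triZeta Site)
open Literature.Probability.RandomPlanarGeometry
open Literature.Probability.RandomPlanarGeometry.SAW
open Summit.CriticalPhenomena.SAWScalingLimit.Theorems.ObservableToSLER.BridgeGate

/-- **Registered sub-goal `stub_cellEqCylinderN`** (self-contained form of `mem_cellN_of_mem_cyl`). -/
theorem stub_cellEqCylinderN : ∀ (Ω : Set ℂ) (δ ρ R C : ℝ) (S T : ℕ → Set HexVertex) (a b : HexVertex) (κ : GateLabel) (γ₀ γ : HexDomainSAW Ω δ a b), γ₀ ∈ productCellN Ω δ ρ R S T a b C → γ₀.walk.support ∈ κ.cellN Ω δ ρ R S T a b → γ ∈ κ.cyl (S κ.n) (T κ.n') Ω δ a b → γ.walk.support ∈ κ.cellN Ω δ ρ R S T a b :=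
  fun _ _ _ _ _ _ _ _ _ _ _ _ hcs h₀ hγ => mem_cellN_of_mem_cyl hcs h₀ hγ

end Summit.CriticalPhenomena.SAWScalingLimit.Theorems.ObservableToSLER.NestedGate

end
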